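import Summits.ResolutionOfSingularities.ResolutionOfSingularities.Theorems.FrobeniusLadderFRationalResolutionStabilizerSubgroup
import Literature.RingTheory.GradedAlgebra.LocalizationDegreeZero
import Mathlib.RingTheory.Localization.Away.Basic
import Mathlib.RingTheory.Localization.Ideal
import HarnessLib

/-!
# Crux `FrobeniusLadder.FRationalResolution` (stmt-ResolutionOfSingularities-15317), line `redirect`,
# stub `stub_diagonalizableQuotientResolution` — census item R3 (localisation step): after inverting
# ONE degree-zero element `g ∉ 𝔔`, every unit degree `b ∈ B_𝔔` carries a GLOBAL homogeneous unit
# of `S_g`, and `𝔔 S_g` is still a point with unit-degree subgroup `B_𝔔`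

For `S` graded by `A` (`GradedAlgebra 𝒮`), a prime `𝔔` and its (finite) unit-degree subgroup
`B = B_𝔔 = {a : some s ∈ S_a lies outside 𝔔}` (`…StabilizerSubgroup`), put
`g = ∏_{b ∈ B} s_b s_{−b} ∈ S_0 ∖ 𝔔` for chosen witnesses `s_b ∈ S_b ∖ 𝔔`. In any localization
`L = S_g` (`IsLocalization.Away g L`), graded by `locPiece` (`Literature.RingTheory.GradedAlgebra`,
degree-zero part `(S_0)_g`):

* `exists_away_witnesses` — the element `g ∈ S_0 ∖ 𝔔` with `s_b ∣ g` for all `b ∈ B`;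
* `mem_map_of_mem_locPiece` — for `a ∉ B`, `L_a ⊆ 𝔔 L`;
* `exists_away_units` — **the package**: `𝔔 L` is a prime contracting to `𝔔`, its unit-degree
  subgroup for the grading `locPiece` is again `B` (`a ∈ B ↔ some x ∈ L_a lies outside 𝔔 L`), and
  every `b ∈ B` carries a homogeneous UNIT of `L` — the input of `…CoarseningEtale` (finite
  étaleness of `(S_0)_g → (S_g)^{(B)}`, tame case) and of `…Coarsening.exists_coarsening_fixed`
  (`𝔔 L` is a fixed point of the `A/B`-coarsened grading of `S_g`).

Honest label: brick R3, localisation step (no stub closed). No definitions, no named facts, no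
sorry. [folklore; cite: SGA3, Exp. VIII §4–5; EGAII, (2.2.1)–(2.2.2)]
-/

noncomputable section

-- single-problem summit: the doubled namespace component is forced
set_option linter.dupNamespace false

open DirectSum
open Literature.RingTheory.GradedAlgebra

namespace Summit.ResolutionOfSingularities.ResolutionOfSingularities.Theorems.FRationalResolution.AwayUnits

universe u v w v'

variable {k : Type u} [CommRing k] {A : Type w} [DecidableEq A] [AddCommGroup A] {S : Type v}
  [CommRing S] [Algebra k S] (𝒮 : A → Submodule k S) [GradedAlgebra 𝒮]

/-- Powers of a degree-zero element have degree zero. [folklore] -/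
theorem powers_subset_gradeZero {g : S} (hg : g ∈ 𝒮 0) : ∀ t ∈ Submonoid.powers g, t ∈ 𝒮 0 := by
  rintro t ⟨n, rfl⟩
  exact (SetLike.GradeZero.subring 𝒮).pow_mem hg n

/-- **One degree-zero element outside `𝔔` divisible by witnesses of all unit degrees.** For the
finite unit-degree subgroup `B` of `𝔔` there is `g ∈ S_0 ∖ 𝔔` and, for every `b ∈ B`, some
`s_b ∈ S_b ∖ 𝔔` dividing `g` (`g = ∏_b s_b s_{−b}`). [folklore; cite: SGA3, Exp. VIII §4–5] -/
theorem exists_away_witnesses (𝔔 : Ideal S) [𝔔.IsPrime] (B : AddSubgroup A)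
    (hB : ∀ a : A, a ∈ B ↔ ∃ s ∈ 𝒮 a, s ∉ 𝔔) [Finite B] :
    ∃ g ∈ 𝒮 0, g ∉ 𝔔 ∧ ∀ b ∈ B, ∃ s ∈ 𝒮 b, s ∉ 𝔔 ∧ s ∣ g := by
  classical
  haveI : Fintype B := Fintype.ofFinite B
  choose s hs hsQ using fun b : B => (hB (b : A)).1 b.2
  -- the factor attached to `b`: `s_b s_{-b} ∈ S_0 ∖ 𝔔`
  let t : B → S := fun b => s b * s (-b)
  have ht0 : ∀ b, t b ∈ 𝒮 0 := by
    intro b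
    have h := SetLike.mul_mem_graded (hs b) (hs (-b))
    rwa [AddSubgroup.coe_neg, add_neg_cancel] at h
  have htQ : ∀ b, t b ∉ 𝔔 := by
    intro b h
    rcases (inferInstance : 𝔔.IsPrime).mem_or_mem h with h1 | h1
    · exact hsQ b h1
    · exact hsQ (-b) h1
  refine ⟨∏ b, t b, ?_, ?_, fun b hb => ⟨s ⟨b, hb⟩, hs ⟨b, hb⟩, hsQ ⟨b, hb⟩, ?_⟩⟩
  · exact Finset.prod_induction t (fun x => x ∈ 𝒮 0)
      (fun x y hx hy => (SetLike.GradeZero.subring 𝒮).mul_mem hx hy)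
      (SetLike.one_mem_graded 𝒮) (fun b _ => ht0 b)
  · exact Finset.prod_induction t (fun x => x ∉ 𝔔)
      (fun x y hx hy h => ((inferInstance : 𝔔.IsPrime).mem_or_mem h).elim hx hy)
      (fun h1 => (inferInstance : 𝔔.IsPrime).ne_top ((Ideal.eq_top_iff_one 𝔔).mpr h1))
      (fun b _ => htQ b)
  · exact Dvd.dvd.trans (dvd_mul_right (s ⟨b, hb⟩) (s (-⟨b, hb⟩)))
      (Finset.dvd_prod_of_mem t (Finset.mem_univ ⟨b, hb⟩))

/-- **Pieces of non-unit degree stay inside `𝔔` after localising**: if `S_a ⊆ 𝔔` (`a ∉ B_𝔔`) then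
`L_a = T⁻¹ S_a ⊆ 𝔔 L` for any localization `L` at degree-zero elements. [folklore] -/
theorem mem_map_of_mem_locPiece (𝔔 : Ideal S) (T : Submonoid S) (hT : ∀ t ∈ T, t ∈ 𝒮 0)
    (L : Type v') [CommRing L] [Algebra S L] [Algebra k L] [IsScalarTower k S L] [IsLocalization T L]
    {a : A} (ha : ∀ s ∈ 𝒮 a, s ∈ 𝔔) {x : L} (hx : x ∈ locPiece 𝒮 T hT L a) :
    x ∈ 𝔔.map (algebraMap S L) := by
  obtain ⟨t, ht, s, hs, htx⟩ := (mem_locPiece_iff (hT := hT)).1 hx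
  obtain ⟨w, hw⟩ := (IsLocalization.map_units L ⟨t, ht⟩).exists_left_inv
  have hx' : x = w * algebraMap S L s := by
    calc x = (w * algebraMap S L t) * x := by rw [show algebraMap S L t = algebraMap S L (⟨t, ht⟩ : T)
              from rfl, hw, one_mul]
      _ = w * (algebraMap S L t * x) := by ring
      _ = w * algebraMap S L s := by rw [htx]
  rw [hx']
  exact Ideal.mul_mem_left _ _ (Ideal.mem_map_of_mem _ (ha s hs))

/-- **R3, localisation step.** Let `B` be the (finite) unit-degree subgroup of the prime `𝔔`.
There is `g ∈ S_0 ∖ 𝔔` such that in EVERY localization `L = S_g` (graded by `locPiece`, with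
`(S_g)_0 = (S_0)_g`): `𝔔 L` is a prime ideal contracting to `𝔔`; a degree `a` carries an element
of `L_a` outside `𝔔 L` iff `a ∈ B` (the unit-degree subgroup is unchanged, so `𝔔 L` is a FIXED
point of the `A/B`-coarsened grading of `L`, `…Coarsening.exists_coarsening_fixed`); and every
`b ∈ B` carries a homogeneous UNIT of `L` (so `(S_0)_g → (S_g)^{(B)}` is finite étale in the tame
case, `…CoarseningEtale.exists_ringHom_etale_finite`). [folklore; cite: SGA3, Exp. VIII §4–5] -/
theorem exists_away_units (𝔔 : Ideal S) [𝔔.IsPrime] (B : AddSubgroup A)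
    (hB : ∀ a : A, a ∈ B ↔ ∃ s ∈ 𝒮 a, s ∉ 𝔔) [Finite B] :
    ∃ (g : S) (_ : g ∈ 𝒮 0) (_ : g ∉ 𝔔) (hT : ∀ t ∈ Submonoid.powers g, t ∈ 𝒮 0),
      ∀ (L : Type v') [CommRing L] [Algebra S L] [Algebra k L] [IsScalarTower k S L]
        [IsLocalization.Away g L],
        (𝔔.map (algebraMap S L)).IsPrime ∧
        (𝔔.map (algebraMap S L)).comap (algebraMap S L) = 𝔔 ∧
        (∀ a : A, a ∈ B ↔ ∃ x ∈ locPiece 𝒮 (Submonoid.powers g) hT L a,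
          x ∉ 𝔔.map (algebraMap S L)) ∧
        (∀ a : A, a ∉ B → ∀ x ∈ locPiece 𝒮 (Submonoid.powers g) hT L a,
          x ∈ 𝔔.map (algebraMap S L)) ∧
        (∀ b ∈ B, ∃ x ∈ locPiece 𝒮 (Submonoid.powers g) hT L b, IsUnit x) := by
  obtain ⟨g, hg0, hgQ, hwit⟩ := exists_away_witnesses 𝒮 𝔔 B hB
  have hT := powers_subset_gradeZero 𝒮 hg0
  refine ⟨g, hg0, hgQ, hT, fun L _ _ _ _ _ => ?_⟩
  have hdisj : Disjoint ((Submonoid.powers g : Submonoid S) : Set S) (𝔔 : Set S) := by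
    rw [Set.disjoint_left]
    rintro _ ⟨n, rfl⟩ h
    exact hgQ ((inferInstance : 𝔔.IsPrime).mem_of_pow_mem n h)
  have hprime : (𝔔.map (algebraMap S L)).IsPrime :=
    IsLocalization.isPrime_of_isPrime_disjoint (Submonoid.powers g) L 𝔔 inferInstance hdisj
  have hcomap : (𝔔.map (algebraMap S L)).comap (algebraMap S L) = 𝔔 :=
    IsLocalization.under_map_of_isPrime_disjoint (Submonoid.powers g) L inferInstance hdisj
  -- outside `B`: pieces inside `𝔔 L`
  have hout : ∀ a : A, a ∉ B → ∀ x ∈ locPiece 𝒮 (Submonoid.powers g) hT L a,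
      x ∈ 𝔔.map (algebraMap S L) := by
    intro a haB x hx
    have ha : ∀ s ∈ 𝒮 a, s ∈ 𝔔 := fun s hs => by
      by_contra hsQ
      exact haB ((hB a).2 ⟨s, hs, hsQ⟩)
    exact mem_map_of_mem_locPiece 𝒮 𝔔 _ hT L ha hx
  -- inside `B`: homogeneous units
  have hunit : ∀ b ∈ B, ∃ x ∈ locPiece 𝒮 (Submonoid.powers g) hT L b,
      IsUnit x ∧ x ∉ 𝔔.map (algebraMap S L) := by
    intro b hb
    obtain ⟨s, hs, -, hsg⟩ := hwit b hb
    have hu : IsUnit (algebraMap S L s) :=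
      isUnit_of_dvd_unit (map_dvd (algebraMap S L) hsg) (IsLocalization.Away.algebraMap_isUnit g)
    exact ⟨algebraMap S L s, algebraMap_mem_locPiece hT hs, hu,
      fun h => hprime.ne_top (Ideal.eq_top_of_isUnit_mem _ h hu)⟩
  refine ⟨hprime, hcomap, fun a => ⟨fun ha => ?_, fun ⟨x, hx, hxQ⟩ => ?_⟩, hout,
    fun b hb => ?_⟩
  · obtain ⟨x, hx, -, hxQ⟩ := hunit a ha
    exact ⟨x, hx, hxQ⟩
  · by_contra haB
    exact hxQ (hout a haB x hx)
  · obtain ⟨x, hx, hxu, -⟩ := hunit b hb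
    exact ⟨x, hx, hxu⟩

end Summit.ResolutionOfSingularities.ResolutionOfSingularities.Theorems.FRationalResolution.AwayUnits

end
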